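import Mathlib

/-!
# Crux `TateFamilyKernel` (stmt-KontsevichZagierPeriods-9130), line `Sketch`:
# stub `stub_tateFaceCoprime` (wave 14, pure algebra — the face denominator is square-free)

For a non-constant `τ ∈ ℚ[s]` the face denominator `D = 1 − ϖ·τ(s)` of a quasi-homogeneous
pencil, viewed as a polynomial in `s` over the field `K = ℚ(ϖ) = RatFunc ℚ` (the parameter
`ϖ = RatFunc.X` enters as the constant coefficient `Polynomial.C RatFunc.X`), is coprime to its
`s`-derivative `D' = −ϖ·τ'(s)`. This is the square-freeness input of Hermite reduction in `s`
over `ℚ(ϖ)`.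

Proof (transcendence of `ϖ`): `Polynomial.C RatFunc.X` is a unit of `K[s]`, so it suffices that
`D` and `τ'` are coprime; over the algebraic closure `L` of `K` this means no common root
(`Polynomial.isCoprime_iff_aeval_ne_zero_of_isAlgClosed`). A common root `a : L` is a root of the
non-zero `ℚ`-polynomial `τ'`, hence algebraic over `ℚ`, so `τ(a)` is algebraic over `ℚ`; but
`D(a) = 0` reads `ϖ·τ(a) = 1`, i.e. `ϖ = τ(a)⁻¹` is algebraic over `ℚ` — contradicting
`RatFunc.transcendental_X`. [folklore]

Mathlib only; no named fact, no new definition. Helpers live in the sub-namespace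
`TateFaceCoprime`.
-/

noncomputable section

open MeasureTheory Set MvPolynomial

namespace Summit.KontsevichZagierPeriods.InverseLandau.TateFamilyKernel.Descent

namespace TateFaceCoprime

/-- `ϖ = RatFunc.X` stays transcendental over `ℚ` in the algebraic closure of `ℚ(ϖ)`. -/
theorem transcendental_algebraMap_X :
    Transcendental ℚ (algebraMap (RatFunc ℚ) (AlgebraicClosure (RatFunc ℚ)) RatFunc.X) := by
  have hXK : Transcendental ℚ (RatFunc.X : RatFunc ℚ) := by
    convert RatFunc.transcendental_X (K := ℚ)
    exact Subsingleton.elim _ _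
  exact (transcendental_algebraMap_iff
    (algebraMap (RatFunc ℚ) (AlgebraicClosure (RatFunc ℚ))).injective).mpr hXK

/-- The `s`-derivative of the face denominator: `(1 − ϖ·τ)' = −ϖ·τ'` (`ϖ` is a constant
coefficient). -/
theorem derivative_face (τ : Polynomial ℚ) :
    Polynomial.derivative
        (1 - Polynomial.C (RatFunc.X : RatFunc ℚ) * τ.map (algebraMap ℚ (RatFunc ℚ)))
      = -Polynomial.C (RatFunc.X : RatFunc ℚ) *
          (Polynomial.derivative τ).map (algebraMap ℚ (RatFunc ℚ)) := by
  simp [Polynomial.derivative_map]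

/-- Key step: `1 − ϖ·τ(s)` and `τ'(s)` are coprime in `ℚ(ϖ)[s]` for a non-constant
`τ ∈ ℚ[s]` (no common root in an algebraic closure, by transcendence of `ϖ`). -/
theorem isCoprime_face_derivative (τ : Polynomial ℚ) (hτ : 0 < τ.natDegree) :
    IsCoprime (1 - Polynomial.C (RatFunc.X : RatFunc ℚ) * τ.map (algebraMap ℚ (RatFunc ℚ)))
      ((Polynomial.derivative τ).map (algebraMap ℚ (RatFunc ℚ))) := by
  refine (Polynomial.isCoprime_iff_aeval_ne_zero_of_isAlgClosed (RatFunc ℚ)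
    (AlgebraicClosure (RatFunc ℚ)) _ _).mpr fun a => ?_
  by_contra! h
  obtain ⟨h1, h2⟩ := h
  rw [Polynomial.aeval_map_algebraMap] at h2
  have hτ' : Polynomial.derivative τ ≠ 0 := Polynomial.derivative_ne_zero.mpr hτ.ne'
  have ha : IsAlgebraic ℚ a := ⟨_, hτ', h2⟩
  have hτa : IsAlgebraic ℚ (Polynomial.aeval a τ) := by
    by_contra h
    exact (transcendental_aeval_iff.mp h).1 ha
  simp only [map_sub, map_one, map_mul, Polynomial.aeval_C, Polynomial.aeval_map_algebraMap,
    sub_eq_zero] at h1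
  have hX : algebraMap (RatFunc ℚ) (AlgebraicClosure (RatFunc ℚ)) RatFunc.X
      = (Polynomial.aeval a τ)⁻¹ :=
    eq_inv_of_mul_eq_one_left h1.symm
  exact transcendental_algebraMap_X (hX ▸ hτa.inv)

end TateFaceCoprime

/-- **The face denominator `1 − ϖ·τ(s)` is square-free over `ℚ(ϖ)`.** For a non-constant
`τ ∈ ℚ[s]`, the polynomial `D = 1 − ϖτ(s) ∈ ℚ(ϖ)[s]` is coprime to its `s`-derivative
`−ϖτ'(s)`: a common root `s₀` in an algebraic closure is a root of `τ'`, hence algebraic over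
`ℚ`, and then `ϖ = 1/τ(s₀)` would be algebraic over `ℚ` — but `ϖ` is transcendental.
[folklore] -/
theorem stub_tateFaceCoprime (τ : Polynomial ℚ) (hτ : 0 < τ.natDegree) :
    IsCoprime (1 - Polynomial.C (RatFunc.X : RatFunc ℚ) * τ.map (algebraMap ℚ (RatFunc ℚ)))
      (Polynomial.derivative (1 - Polynomial.C (RatFunc.X : RatFunc ℚ) * τ.map (algebraMap ℚ (RatFunc ℚ)))) := by
  have hu : IsUnit (-Polynomial.C (RatFunc.X : RatFunc ℚ)) :=
    (Polynomial.isUnit_C.mpr (isUnit_iff_ne_zero.mpr RatFunc.X_ne_zero)).neg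
  rw [TateFaceCoprime.derivative_face, isCoprime_mul_unit_left_right hu]
  exact TateFaceCoprime.isCoprime_face_derivative τ hτ

end Summit.KontsevichZagierPeriods.InverseLandau.TateFamilyKernel.Descent

end
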